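import Summits.HodgeConjecture.HodgeConjecture.Theorems.MilnorKExponentialDefs
import Summits.HodgeConjecture.HodgeConjecture.Theorems.MilnorKExponentialSymbolClassesAlgebraicSymbolClassesHodgeType
import Literature.AlgebraicGeometry.HodgeTheory.LefschetzOneOneHolds
import Literature.AlgebraicGeometry.HodgeTheory.HardLefschetzNFoldHolds
import Literature.AlgebraicGeometry.HodgeTheory.TopDegreeClasses
import Literature.AlgebraicGeometry.HodgeTheory.ComplexGysin

/-!
# Stub (W_alg, weights `≥ 3`) `NashSymbolClassesAlgebraicHigh` of the line `NashDescentSketch` — the slices the tree proves, and the reduction of the rest to its band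

Support file for the crux `SymbolClassesAlgebraic` (stmt-HodgeConjecture-17743, route
`MilnorKExponential`), line `NashDescentSketch`, stub (W_alg, `≥ 3`)
`NashSymbolClassesAlgebraicHigh` (`Theorems/MilnorKExponentialDefs`): every rational NASH symbol
class of weight `q + 1 ≥ 3` on a smooth projective complex `n`-fold lies in
`algebraicClasses X (q + 1) = N^{q+1} H^{2q+2}(X(ℂ); ℂ)`.

PROVED here (sorry-free, no definitions, no named facts), none of it using the Nash refinement of
the cocycle (only `IsNashSymbolClass.isSymbolClass` and the landed stub (T)
`stub_symbolClassesHodgeType`: a rational symbol class of weight `q + 1` is a rational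
`(q+1, q+1)`-class):

* `mem_algebraicClasses_above_dim` — above the dimension (`n < q + 1`) EVERY class of
  `H^{2q+2}(X(ℂ); ℂ) = 0` is algebraic (`subsingleton_complexBetti`, Hatcher Thm. 3.26 (c));
* `mem_algebraicClasses_top_degree` — in the top degree (`q + 1 = n`) EVERY class is the class of
  a point (`mem_algebraicClasses_of_degree_top`);
* `mem_algebraicClasses_curveClasses` — in degree `2n - 2` (`q + 2 = n`) every RATIONAL
  `(n-1, n-1)`-class is algebraic: `c = L^{n-2} c'` with `c'` a rational `(1,1)`-class (hard
  Lefschetz, `nonempty_hardLefschetzNFold_holds`), a divisor class by Lefschetz `(1,1)`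
  (`lefschetzOneOne_rational_holds`), and `L^{n-2}(N¹ H²) ⊆ N^{n-1} H^{2n-2}`;
* hence the four slices of the stub `nashSymbolClassesAlgebraicHigh_of_dim_lt` (`n < q + 1`),
  `…_top` (`n = q + 1`), `…_curves` (`n = q + 2`), `…_of_dim_le_three` (`n ≤ 3`, the Hodge
  conjecture for curves, surfaces and threefolds, `hodgeClasses_algebraic_of_dim_le_three_holds`),
  assembled in `nashSymbolClassesAlgebraicHigh_outside_band` (`n ≤ q + 2 ∨ n ≤ 3`);
* `nashSymbolClassesAlgebraicHigh_of_band` (REGISTERED sub-goal) — so the stub REDUCES to its band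
  `2 ≤ q`, `q + 3 ≤ n` (weight `3 ≤ q + 1 ≤ n - 2`, so `n ≥ 5`; first open case
  `(n, q + 1) = (5, 3)`), stated over `IsNashSymbolClass`; `nashSymbolClassesAlgebraicHigh_iff_band`
  records that nothing is lost.

NOT here (the residual, see the report `work/stubs/NashSymbolClassesAlgebraicHigh-report.md`): the
band itself, i.e. step (W_alg) of the idea card
(`Cruxes/SymbolClassesAlgebraic/Ideas/nash-descent-weight-kill.md`): Leray for
`λ : W̄^an → W̄_Zar`, `E₂^{a,b} = Hᵃ(W̄_Zar, 𝒦^M_p ⊗ ℋᵇ_ℚ)`, Bloch–Ogus (7.6) (the image of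
`H^{p-b}(W̄_Zar, ℋ^{p+b})` is `N^{p-b} H^{2p}`), `b = 0` is `CHᵖ = Hᵖ(𝒦^M_p)` (Bloch–Quillen–Kerz),
`b ≥ 1` dies by weights and strictness (Paranjape 1996) — rated "PLAUSIBLE (L–XL), not claimed
proved" by the card itself, and without a carrier in the tree (no Zariski sheaf cohomology, no
`ℋᵇ`, no coniveau spectral sequence; mixed Hodge structures only as the hypothesis structure
`Motives.MixedHodgeStructureOfPair` whose only inhabitant is the unproved named fact `existsDeligne`).

## References

* [VoisinHodgeI2002] C. Voisin, Hodge Theory and Complex Algebraic Geometry I (2002), Thm. 6.25,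
  Rem. 6.27, §7.1.2, Thm. 11.30.
* [VoisinHodgeII2003] C. Voisin, Hodge Theory and Complex Algebraic Geometry II (2003), §9.2.4
  Prop. 9.20, §10.2.3 (proof of Prop. 10.26).
* [HatcherAT2002] A. Hatcher, Algebraic Topology (2002), Thm. 3.26 (c), Prop. 3.29.
* [KerrPearlstein2011] M. Kerr, G. Pearlstein, An exponential history of functions with
  logarithmic growth, in: Topology of Stratified Spaces, MSRI Publ. 58 (2011), §3.1.
* [BlochOgus1974ENS] S. Bloch, A. Ogus, Gersten's conjecture and the homology of schemes, Ann. Sci.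
  ÉNS 7 (1974), (7.6).
-/

noncomputable section

open CategoryTheory AlgebraicGeometry

-- `Summit.HodgeConjecture.HodgeConjecture.Theorems` is the mandated namespace (single-problem summit).
set_option linter.dupNamespace false

namespace Summit.HodgeConjecture.HodgeConjecture.Theorems.MilnorKExponentialNash

open Literature.AlgebraicGeometry Literature.AlgebraicGeometry.HodgeTheory
  Literature.AlgebraicGeometry.Motives

variable {n : ℕ} {X : SchemeOver ℂ}

/-! ### Three facts about ALL (rational Hodge) classes in the extreme degrees -/

/-- **Above the dimension every class is algebraic**: for `n < p`, `H²ᵖ(X(ℂ); ℂ) = 0` (`X(ℂ)` is a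
closed `2n`-manifold, `subsingleton_complexBetti`), so `c = 0 ∈ algebraicClasses X p`.
[cite: HatcherAT2002, §3.3 Thm. 3.26(c)] -/
theorem mem_algebraicClasses_above_dim (hX : IsSmoothProjective n X) {p : ℕ} (hp : n < p)
    (c : complexBetti X (2 * p)) : c ∈ algebraicClasses X p := by
  haveI := subsingleton_complexBetti hX (k := 2 * p) (by omega)
  rw [Subsingleton.elim c 0]
  exact Submodule.zero_mem _

/-- **In the top degree every class is algebraic** (`p = n ≥ 1`: the class of a point,
`mem_algebraicClasses_of_degree_top`; `p = n = 0`: `N⁰ H⁰ = H⁰`). [cite: HatcherAT2002, §3.3 Prop. 3.29]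
[cite: VoisinHodgeI2002, §11.1.2] -/
theorem mem_algebraicClasses_top_degree (hX : IsSmoothProjective n X) {p : ℕ} (hp : p = n)
    (c : complexBetti X (2 * p)) : c ∈ algebraicClasses X p := by
  subst hp
  rcases Nat.eq_zero_or_pos p with rfl | hp0
  · exact hodgeConjectureFor_codim_zero c
  · exact mem_algebraicClasses_of_degree_top hX hp0 c

/-- **Curve classes: every rational `(n-1, n-1)`-class in `H^{2n-2}(X(ℂ); ℂ)` is algebraic**
(`p + 1 = n`). By hard Lefschetz (`nonempty_hardLefschetzNFold_holds`: `L^{n-2} : H² → H^{2n-2}` is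
an isomorphism of rational Hodge structures of type `(n-2, n-2)`), `c = L^{n-2} c'` with `c'` a
rational `(1,1)`-class, which is a divisor class by the Lefschetz theorem on `(1,1)`-classes
(`lefschetzOneOne_rational_holds`), and `L^{n-2}` maps `N¹ H²` into `N^{n-1} H^{2n-2}`
(`HardLefschetzNFold.mem_algebraicClasses_of_index` with `l = 1`, `j = n - 2`).
[cite: VoisinHodgeI2002, Thm. 6.25, Rem. 6.27, §7.1.2 and Thm. 11.30]
[cite: VoisinHodgeII2003, §9.2.4 Prop. 9.20] -/
theorem mem_algebraicClasses_curveClasses (hX : IsSmoothProjective n X) {p : ℕ} (hp : p + 1 = n)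
    (c : complexBetti X (2 * p)) (hc : IsRationalClass c) (hpp : IsOfHodgeType n X (2 * p) p p c) :
    c ∈ algebraicClasses X p := by
  rcases Nat.eq_zero_or_pos p with rfl | hp0
  · exact hodgeConjectureFor_codim_zero c
  · obtain ⟨Λ⟩ := nonempty_hardLefschetzNFold_holds n X hX
    exact Λ.mem_algebraicClasses_of_index (l := 1) (j := p - 1) (by omega) (by omega)
      (fun c' hc' h11 ↦ lefschetzOneOne_rational_holds hX c' hc' h11) c hc hpp

/-! ### The unconditional slices of the stub -/

/-- **(W_alg) above the dimension (`n < q + 1`), for EVERY class**: `H^{2q+2}(X(ℂ); ℂ) = 0`.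
[cite: HatcherAT2002, §3.3 Thm. 3.26(c)] -/
theorem nashSymbolClassesAlgebraicHigh_of_dim_lt ⦃n : ℕ⦄ ⦃X : SchemeOver ℂ⦄
    (hX : IsSmoothProjective n X) {q : ℕ} (hq : n < q + 1) (c : complexBetti X (2 * (q + 1))) :
    c ∈ algebraicClasses X (q + 1) :=
  mem_algebraicClasses_above_dim hX hq c

/-- **(W_alg) in the top degree (`n = q + 1`), for EVERY class**: the class of a point.
[cite: HatcherAT2002, §3.3 Prop. 3.29] [cite: VoisinHodgeI2002, §11.1.2] -/
theorem nashSymbolClassesAlgebraicHigh_top ⦃n : ℕ⦄ ⦃X : SchemeOver ℂ⦄ (hX : IsSmoothProjective n X)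
    {q : ℕ} (hq : n = q + 1) (c : complexBetti X (2 * (q + 1))) :
    c ∈ algebraicClasses X (q + 1) :=
  mem_algebraicClasses_top_degree hX hq.symm c

/-- **(W_alg) for curve classes (`n = q + 2`), unconditionally and without the Nash input**: a
rational (Nash) symbol class of weight `q + 1 = n - 1` is a rational `(n-1, n-1)`-class (stub (T),
`stub_symbolClassesHodgeType`), hence algebraic by hard Lefschetz and Lefschetz `(1,1)`
(`mem_algebraicClasses_curveClasses`).
[cite: VoisinHodgeI2002, Thm. 6.25, Rem. 6.27, §7.1.2 and Thm. 11.30] -/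
theorem nashSymbolClassesAlgebraicHigh_curves ⦃n : ℕ⦄ ⦃X : SchemeOver ℂ⦄
    (hX : IsSmoothProjective n X) {q : ℕ} (hq : n = q + 2) (c : complexBetti X (2 * (q + 1)))
    (hc : IsRationalClass c) (hs : IsNashSymbolClass n X q c) : c ∈ algebraicClasses X (q + 1) :=
  mem_algebraicClasses_curveClasses hX (by omega) c hc
    (stub_symbolClassesHodgeType hX q c hc hs.isSymbolClass)

/-- **(W_alg) in dimension `≤ 3`, unconditionally and without the Nash input**: a rational (Nash)
symbol class of weight `q + 1` is a rational `(q+1, q+1)`-class (stub (T)), hence algebraic by the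
Hodge conjecture for curves, surfaces and threefolds (`hodgeClasses_algebraic_of_dim_le_three_holds`:
Lefschetz `(1,1)` and hard Lefschetz). [cite: VoisinHodgeII2003, §10.2.3 proof of Prop. 10.26] -/
theorem nashSymbolClassesAlgebraicHigh_of_dim_le_three ⦃n : ℕ⦄ ⦃X : SchemeOver ℂ⦄ (hn : n ≤ 3)
    (hX : IsSmoothProjective n X) (q : ℕ) (c : complexBetti X (2 * (q + 1))) (hc : IsRationalClass c)
    (hs : IsNashSymbolClass n X q c) : c ∈ algebraicClasses X (q + 1) :=
  hodgeClasses_algebraic_of_dim_le_three_holds hn hX (q + 1) c hc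
    (stub_symbolClassesHodgeType hX q c hc hs.isSymbolClass)

/-- **(W_alg) outside the band `q + 3 ≤ n`, `4 ≤ n`** (the four slices assembled: `n ≤ q + 2`
splits as `n < q + 1` / `n = q + 1` / `n = q + 2`). [cite: VoisinHodgeI2002, Thm. 6.25 and Thm. 11.30]
[cite: VoisinHodgeII2003, §10.2.3 proof of Prop. 10.26] -/
theorem nashSymbolClassesAlgebraicHigh_outside_band ⦃n : ℕ⦄ ⦃X : SchemeOver ℂ⦄
    (hX : IsSmoothProjective n X) (q : ℕ) (hband : n ≤ q + 2 ∨ n ≤ 3)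
    (c : complexBetti X (2 * (q + 1))) (hc : IsRationalClass c) (hs : IsNashSymbolClass n X q c) :
    c ∈ algebraicClasses X (q + 1) := by
  rcases hband with hle | hle3
  · rcases Nat.lt_or_ge n (q + 1) with hlt | hge
    · exact nashSymbolClassesAlgebraicHigh_of_dim_lt hX hlt c
    · rcases eq_or_lt_of_le hge with heq | hgt
      · exact nashSymbolClassesAlgebraicHigh_top hX heq.symm c
      · exact nashSymbolClassesAlgebraicHigh_curves hX (by omega) c hc hs
  · exact nashSymbolClassesAlgebraicHigh_of_dim_le_three hle3 hX q c hc hs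

/-! ### The residual: (W_alg, `≥ 3`) reduces to its band -/

/-- **(W_alg, weights `≥ 3`) from its band.** If every rational Nash symbol class of weight
`q + 1 ≥ 3` on a smooth projective complex `n`-fold with `q + 3 ≤ n` (weight `≤ n - 2`, so `n ≥ 5`;
first open case `(n, q + 1) = (5, 3)`) is algebraic — the content of step (W_alg) of the card
(Leray for `λ : W̄^an → W̄_Zar`, Bloch–Ogus (7.6), Bloch–Quillen–Kerz, strictness) — then the stub
holds: the cases `n ≤ q + 2` and `n ≤ 3` are `nashSymbolClassesAlgebraicHigh_outside_band`
(no classes above the dimension, classes of points, curve classes by hard Lefschetz and Lefschetz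
`(1,1)`, the Hodge conjecture in dimension `≤ 3`). [cite: BlochOgus1974ENS, (7.6)]
[cite: VoisinHodgeI2002, Thm. 6.25 and Thm. 11.30] -/
theorem nashSymbolClassesAlgebraicHigh_of_band :
    (∀ ⦃n : ℕ⦄ ⦃X : SchemeOver ℂ⦄, IsSmoothProjective n X →
      ∀ (q : ℕ), 2 ≤ q → q + 3 ≤ n →
        ∀ (c : complexBetti X (2 * (q + 1))), IsRationalClass c → IsNashSymbolClass n X q c →
          c ∈ algebraicClasses X (q + 1)) →
    NashSymbolClassesAlgebraicHigh := by
  intro h n X hX q hq c hc hs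
  by_cases hband : n ≤ q + 2 ∨ n ≤ 3
  · exact nashSymbolClassesAlgebraicHigh_outside_band hX q hband c hc hs
  · push Not at hband
    exact h hX q hq (by omega) c hc hs

/-- **(W_alg, weights `≥ 3`) IS its band**: the stub is equivalent to its restriction to
`2 ≤ q`, `q + 3 ≤ n` (the converse being specialisation). [cite: BlochOgus1974ENS, (7.6)]
[cite: VoisinHodgeI2002, Thm. 6.25 and Thm. 11.30] -/
theorem nashSymbolClassesAlgebraicHigh_iff_band :
    NashSymbolClassesAlgebraicHigh ↔
      ∀ ⦃n : ℕ⦄ ⦃X : SchemeOver ℂ⦄, IsSmoothProjective n X →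
        ∀ (q : ℕ), 2 ≤ q → q + 3 ≤ n →
          ∀ (c : complexBetti X (2 * (q + 1))), IsRationalClass c → IsNashSymbolClass n X q c →
            c ∈ algebraicClasses X (q + 1) :=
  ⟨fun h _ _ hX q hq _ c hc hs ↦ h hX q hq c hc hs, nashSymbolClassesAlgebraicHigh_of_band⟩

end Summit.HodgeConjecture.HodgeConjecture.Theorems.MilnorKExponentialNash

end
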